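import Literature.Barriers.AtomisticToContinuum.NoBVEstimatesMultiDSupSmallness
import HarnessLib

/-!
# The family `W_δ(t) = ρ_δ ⋆ U_δ(t)` of regularised solutions: definition, exact evolution
# equation, initial slice

Brick B-ε, §2b, of the Kato existence programme for the symmetrizable branch of Rauch's Local
Existence Theorem (towards `Rauch1986_smallAmplitudeExpansionL2`). For every `δ > 0` a two-sided
solution `U_δ : ℝ → L²` of the Friedrichs-regularised cut-off quasilinear system issued from the
datum `u₀` is CHOSEN (`flow`, from `exists_regularised_flow_real`), and the smooth fields
`W_δ(t) = ρ_δ ⋆ U_δ(t)` are collected into one total function `Wfam δ t x` (junk `0` for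
`δ ≤ 0`). This file records what is exact about them [TaylorPDEIII2011, Ch. 16, §1, (1.9)]:

* `contDiff_Wfam` — every slice is `C^∞` in `x`;
* `hasDerivAt_cwd_Wfam` — **the evolution equation of every spatial word derivative**:
  `d/dt ∂_c W_δ(t)(x) = -∂_c(ρ_δ ⋆ ρ_δ ⋆ G(W_δ(t)))(x)` (pointwise values of `∂_c(ρ_δ ⋆ ·)` are a
  bounded functional of the `L²` curve; `smoothRep_regField_eq`);
* `fderiv_eq_sum_smulRight_cwd`, `hasDerivAt_fderiv_Wfam` — the same for the full spatial
  derivative `D W_δ(t)(x) = Σᵢ πᵢ ⊗ ∂ᵢW_δ(t)(x)`;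
* `Wfam_zero_eq`, `norm_Wfam_zero_sub_le` — the initial slice is `ρ_δ ⋆ u₀`, within
  `δ Σᵢ sup‖∂ᵢu₀‖` of `u₀` in the sup norm.

Everything is proved; no named fact and no `sorry` is introduced.

## References

* [TaylorPDEIII2011] M. E. Taylor, *Partial Differential Equations III*, 2nd ed. (2011), Ch. 16,
  §1, (1.9)–(1.10).
* [Majda1984] A. Majda, *Compressible Fluid Flow and Systems of Conservation Laws in Several
  Space Variables* (1984), Ch. 2, §2.1.
-/

noncomputable section

open MeasureTheory Set Function Filter Metric ContinuousLinearMap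
open scoped ContDiff Topology ENNReal NNReal Convolution RealInnerProductSpace

namespace Literature.Barriers.AtomisticToContinuum

open Literature.Analysis.PDE Literature.Analysis.FunctionSpaces Literature.Analysis.ODE

variable {d k : ℕ}

variable {M L : ℝ} {a : Fin d → EuclideanSpace ℝ (Fin k) → (EuclideanSpace ℝ (Fin k) →L[ℝ] EuclideanSpace ℝ (Fin k))}
  {b : EuclideanSpace ℝ (Fin k) → EuclideanSpace ℝ (Fin k)}
  {u₀ : EuclideanSpace ℝ (Fin d) → EuclideanSpace ℝ (Fin k)}

/-! ### The chosen flows and the family `W_δ` -/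

/-- **The chosen two-sided regularised flow** `U_δ : ℝ → L²` from the datum `u₀`
(`exists_regularised_flow_real`). [cite: TaylorPDEIII2011, Ch. 16 §1, (1.9)] -/
def flow (h : IsTameCoeff M L a b) {δ : ℝ} (hδ : 0 < δ) (hu₀ : ContDiff ℝ ∞ u₀)
    (hu₀c : HasCompactSupport u₀) :
    ℝ → Lp (EuclideanSpace ℝ (Fin k)) 2 (volume : Measure (EuclideanSpace ℝ (Fin d))) :=
  Classical.choose (exists_regularised_flow_real h hδ (dataL2 hu₀ hu₀c))

/-- `U_δ(0) = u₀`. [folklore] -/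
theorem flow_zero (h : IsTameCoeff M L a b) {δ : ℝ} (hδ : 0 < δ) (hu₀ : ContDiff ℝ ∞ u₀)
    (hu₀c : HasCompactSupport u₀) : flow h hδ hu₀ hu₀c 0 = dataL2 hu₀ hu₀c :=
  (Classical.choose_spec (exists_regularised_flow_real h hδ (dataL2 hu₀ hu₀c))).1

/-- `U_δ' = F_δ(U_δ)` on all of `ℝ`. [folklore] -/
theorem hasDerivAt_flow (h : IsTameCoeff M L a b) {δ : ℝ} (hδ : 0 < δ) (hu₀ : ContDiff ℝ ∞ u₀)
    (hu₀c : HasCompactSupport u₀) (t : ℝ) :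
    HasDerivAt (flow h hδ hu₀ hu₀c) (regField h hδ (flow h hδ hu₀ hu₀c t)) t :=
  (Classical.choose_spec (exists_regularised_flow_real h hδ (dataL2 hu₀ hu₀c))).2 t

/-- The flow is continuous. [folklore] -/
theorem continuous_flow (h : IsTameCoeff M L a b) {δ : ℝ} (hδ : 0 < δ) (hu₀ : ContDiff ℝ ∞ u₀)
    (hu₀c : HasCompactSupport u₀) : Continuous (flow h hδ hu₀ hu₀c) :=
  continuous_iff_continuousAt.2 fun t => (hasDerivAt_flow h hδ hu₀ hu₀c t).continuousAt

/-- **The family `W_δ(t)(x) = (ρ_δ ⋆ U_δ(t))(x)`** as a total function of `δ` (value `0` for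
`δ ≤ 0`). [cite: TaylorPDEIII2011, Ch. 16 §1, (1.9)] -/
def Wfam (h : IsTameCoeff M L a b) (hu₀ : ContDiff ℝ ∞ u₀) (hu₀c : HasCompactSupport u₀)
    (δ t : ℝ) (x : EuclideanSpace ℝ (Fin d)) : EuclideanSpace ℝ (Fin k) :=
  if hδ : 0 < δ then smoothRep (moll (Fin d) hδ) (flow h hδ hu₀ hu₀c t) x else 0

/-- Unfolding for `δ > 0`. [folklore] -/
theorem Wfam_eq (h : IsTameCoeff M L a b) (hu₀ : ContDiff ℝ ∞ u₀) (hu₀c : HasCompactSupport u₀)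
    {δ : ℝ} (hδ : 0 < δ) (t : ℝ) :
    Wfam h hu₀ hu₀c δ t = smoothRep (moll (Fin d) hδ) (flow h hδ hu₀ hu₀c t) := by
  funext x
  simp [Wfam, hδ]

/-- Every slice `W_δ(t)` (`δ > 0`) is smooth. [folklore] -/
theorem contDiff_Wfam (h : IsTameCoeff M L a b) (hu₀ : ContDiff ℝ ∞ u₀) (hu₀c : HasCompactSupport u₀)
    {δ : ℝ} (hδ : 0 < δ) (t : ℝ) : ContDiff ℝ ∞ (Wfam h hu₀ hu₀c δ t) := by
  rw [Wfam_eq h hu₀ hu₀c hδ]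
  exact contDiff_smoothRep (contDiff_moll hδ) (hasCompactSupport_moll hδ) _

/-! ### The evolution equation of the spatial word derivatives -/

/-- **`d/dt ∂_c W_δ(t)(x) = -∂_c(ρ_δ ⋆ (ρ_δ ⋆ G(W_δ(t))))(x)`** for every word `c`, every `t` and
every `x`. [cite: TaylorPDEIII2011, Ch. 16 §1, (1.9)–(1.10)] -/
theorem hasDerivAt_cwd_Wfam (h : IsTameCoeff M L a b) (hu₀ : ContDiff ℝ ∞ u₀)
    (hu₀c : HasCompactSupport u₀) {δ : ℝ} (hδ : 0 < δ) (c : List (Fin d)) (t : ℝ)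
    (x : EuclideanSpace ℝ (Fin d)) :
    HasDerivAt (fun τ => cwd c (Wfam h hu₀ hu₀c δ τ) x)
      (-cwd c (moll (Fin d) hδ ⋆[lsmul ℝ ℝ, volume] (moll (Fin d) hδ ⋆[lsmul ℝ ℝ, volume]
        gfield a b (Wfam h hu₀ hu₀c δ t))) x) t := by
  set ρ := moll (Fin d) hδ with hρ
  set U := flow h hδ hu₀ hu₀c with hU
  -- the word derivative of the slice is the evaluation functional of the kernel `∂_c ρ`
  have hrep : ∀ τ, cwd c (Wfam h hu₀ hu₀c δ τ) x =
      evalL2 (cwd c ρ) (continuous_cwd_moll hδ c) (hasCompactSupport_cwd_moll hδ c) x (U τ) := by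
    intro τ
    rw [Wfam_eq h hu₀ hu₀c hδ, cwd_smoothRep (contDiff_moll hδ) (hasCompactSupport_moll hδ),
      evalL2_apply, smoothRep_def]
  have h1 := ((evalL2 (cwd c ρ) (continuous_cwd_moll hδ c) (hasCompactSupport_cwd_moll hδ c) x :
    Lp (EuclideanSpace ℝ (Fin k)) 2 (volume : Measure (EuclideanSpace ℝ (Fin d))) →L[ℝ]
      EuclideanSpace ℝ (Fin k)).hasFDerivAt).comp_hasDerivAt t (hasDerivAt_flow h hδ hu₀ hu₀c t)
  -- identify the derivative
  have h2 : (evalL2 (cwd c ρ) (continuous_cwd_moll hδ c) (hasCompactSupport_cwd_moll hδ c) x)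
      (regField h hδ (U t)) = -cwd c (ρ ⋆[lsmul ℝ ℝ, volume] (ρ ⋆[lsmul ℝ ℝ, volume]
        gfield a b (Wfam h hu₀ hu₀c δ t))) x := by
    rw [evalL2_apply, ← smoothRep_def, ← cwd_smoothRep (contDiff_moll hδ) (hasCompactSupport_moll hδ),
      smoothRep_regField_eq h hδ (U t), Wfam_eq h hu₀ hu₀c hδ]
    have hGm : MemLp (gfield a b (smoothRep ρ (U t))) 2 (volume : Measure (EuclideanSpace ℝ (Fin d))) :=
      (memLp_gfield_smoothRep h hδ (U t)).1
    have hGl : LocallyIntegrable (gfield a b (smoothRep ρ (U t))) (volume : Measure (EuclideanSpace ℝ (Fin d))) :=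
      hGm.locallyIntegrable one_le_two
    have hρG : ContDiff ℝ ∞ (ρ ⋆[lsmul ℝ ℝ, volume] gfield a b (smoothRep ρ (U t))) :=
      contDiff_convolution_kernel (contDiff_moll hδ) (hasCompactSupport_moll hδ) hGl
    have hρρG : ContDiff ℝ ∞ (ρ ⋆[lsmul ℝ ℝ, volume] (ρ ⋆[lsmul ℝ ℝ, volume] gfield a b (smoothRep ρ (U t)))) :=
      contDiff_convolution_kernel (contDiff_moll hδ) (hasCompactSupport_moll hδ)
        hρG.continuous.locallyIntegrable
    rw [show (fun y => -(ρ ⋆[lsmul ℝ ℝ, volume] (ρ ⋆[lsmul ℝ ℝ, volume] gfield a b (smoothRep ρ (U t)))) y)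
        = fun y => -((ρ ⋆[lsmul ℝ ℝ, volume] (ρ ⋆[lsmul ℝ ℝ, volume] gfield a b (smoothRep ρ (U t)))) y)
        from rfl, cwd_neg hρρG]
  have h3 : (fun τ => cwd c (Wfam h hu₀ hu₀c δ τ) x) =
      (evalL2 (cwd c ρ) (continuous_cwd_moll hδ c) (hasCompactSupport_cwd_moll hδ c) x) ∘ U :=
    funext hrep
  rw [h3, ← h2]
  exact h1

/-- The case of the empty word: **`d/dt W_δ(t)(x) = -(ρ_δ ⋆ (ρ_δ ⋆ G(W_δ(t))))(x)`**.
[cite: TaylorPDEIII2011, Ch. 16 §1, (1.9)] -/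
theorem hasDerivAt_Wfam (h : IsTameCoeff M L a b) (hu₀ : ContDiff ℝ ∞ u₀)
    (hu₀c : HasCompactSupport u₀) {δ : ℝ} (hδ : 0 < δ) (t : ℝ) (x : EuclideanSpace ℝ (Fin d)) :
    HasDerivAt (fun τ => Wfam h hu₀ hu₀c δ τ x)
      (-(moll (Fin d) hδ ⋆[lsmul ℝ ℝ, volume] (moll (Fin d) hδ ⋆[lsmul ℝ ℝ, volume]
        gfield a b (Wfam h hu₀ hu₀c δ t))) x) t := by
  simpa using hasDerivAt_cwd_Wfam h hu₀ hu₀c hδ [] t x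

/-! ### The full spatial derivative through the frame -/

/-- **`Dg(x) = Σᵢ πᵢ ⊗ ∂ᵢg(x)`**: the Fréchet derivative of a map on `ℝᵈ` as the sum of the
coordinate functionals tensored with the coordinate derivatives. [folklore] -/
theorem fderiv_eq_sum_smulRight_cwd {F : Type*} [NormedAddCommGroup F] [NormedSpace ℝ F]
    (g : EuclideanSpace ℝ (Fin d) → F) (x : EuclideanSpace ℝ (Fin d)) :
    fderiv ℝ g x = ∑ i, (EuclideanSpace.proj i : EuclideanSpace ℝ (Fin d) →L[ℝ] ℝ).smulRight
      (cwd [i] g x) := by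
  ext v
  rw [fderiv_apply_eq_sum_coord g x v]
  simp

/-- **`d/dt D W_δ(t)(x) = -D(ρ_δ ⋆ ρ_δ ⋆ G(W_δ(t)))(x)`** (in the operator norm).
[cite: TaylorPDEIII2011, Ch. 16 §1, (1.10)] -/
theorem hasDerivAt_fderiv_Wfam (h : IsTameCoeff M L a b) (hu₀ : ContDiff ℝ ∞ u₀)
    (hu₀c : HasCompactSupport u₀) {δ : ℝ} (hδ : 0 < δ) (t : ℝ) (x : EuclideanSpace ℝ (Fin d)) :
    HasDerivAt (fun τ => fderiv ℝ (Wfam h hu₀ hu₀c δ τ) x)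
      (-fderiv ℝ (moll (Fin d) hδ ⋆[lsmul ℝ ℝ, volume] (moll (Fin d) hδ ⋆[lsmul ℝ ℝ, volume]
        gfield a b (Wfam h hu₀ hu₀c δ t))) x) t := by
  have heq : (fun τ => fderiv ℝ (Wfam h hu₀ hu₀c δ τ) x) = fun τ =>
      ∑ i, (EuclideanSpace.proj i : EuclideanSpace ℝ (Fin d) →L[ℝ] ℝ).smulRight
        (cwd [i] (Wfam h hu₀ hu₀c δ τ) x) := funext fun τ => fderiv_eq_sum_smulRight_cwd _ x
  rw [heq, fderiv_eq_sum_smulRight_cwd, ← Finset.sum_neg_distrib]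
  refine HasDerivAt.fun_sum fun i _ => ?_
  have h1 := hasDerivAt_cwd_Wfam h hu₀ hu₀c hδ [i] t x
  -- `y ↦ πᵢ ⊗ y` is a continuous linear map
  set Λ := ContinuousLinearMap.smulRightL ℝ (EuclideanSpace ℝ (Fin d)) (EuclideanSpace ℝ (Fin k))
    (EuclideanSpace.proj i : EuclideanSpace ℝ (Fin d) →L[ℝ] ℝ) with hΛ
  have h2 := (Λ.hasFDerivAt).comp_hasDerivAt t h1
  have h3 : HasDerivAt (fun τ => Λ (cwd [i] (Wfam h hu₀ hu₀c δ τ) x))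
      (Λ (-cwd [i] (moll (Fin d) hδ ⋆[lsmul ℝ ℝ, volume] (moll (Fin d) hδ ⋆[lsmul ℝ ℝ, volume]
        gfield a b (Wfam h hu₀ hu₀c δ t))) x)) t := h2
  rw [map_neg] at h3
  exact h3

/-! ### The initial slice -/

/-- **`W_δ(0) = ρ_δ ⋆ u₀`.** [folklore] -/
theorem Wfam_zero_eq (h : IsTameCoeff M L a b) (hu₀ : ContDiff ℝ ∞ u₀) (hu₀c : HasCompactSupport u₀)
    {δ : ℝ} (hδ : 0 < δ) :
    Wfam h hu₀ hu₀c δ 0 = moll (Fin d) hδ ⋆[lsmul ℝ ℝ, volume] u₀ := by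
  rw [Wfam_eq h hu₀ hu₀c hδ, flow_zero, smoothRep_def, dataL2]
  exact convolution_kernel_congr_ae (MemLp.coeFn_toLp (memLp_cwd_data hu₀ hu₀c []))

/-- **`‖W_δ(0)(x) - u₀(x)‖ ≤ δ Σᵢ sup‖∂ᵢu₀‖`.** [cite: Evans2010, App. C.4 Thm. 7] -/
theorem norm_Wfam_zero_sub_le (h : IsTameCoeff M L a b) (hu₀ : ContDiff ℝ ∞ u₀)
    (hu₀c : HasCompactSupport u₀) {δ : ℝ} (hδ : 0 < δ) {K : Fin d → ℝ}
    (hK : ∀ i y, ‖cwd [i] u₀ y‖ ≤ K i) (x : EuclideanSpace ℝ (Fin d)) :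
    ‖Wfam h hu₀ hu₀c δ 0 x - u₀ x‖ ≤ δ * ∑ i, K i := by
  rw [Wfam_zero_eq h hu₀ hu₀c hδ]
  have hDg : ∀ y, ‖fderiv ℝ u₀ y‖ ≤ ∑ i, K i := fun y =>
    (norm_fderiv_le_sum_cwd u₀ y).trans (Finset.sum_le_sum fun i _ => hK i y)
  have := norm_normed_convolution_sub_self_le (bump (Fin d) hδ) (hu₀.of_le (by exact_mod_cast le_top))
    (x := x) (fun y _ => hDg y)
  simp only [bump_rOut] at this
  exact this

/-- All word derivatives of the datum are bounded. [folklore] -/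
theorem exists_bound_cwd_data (hu₀ : ContDiff ℝ ∞ u₀) (hu₀c : HasCompactSupport u₀) (c : List (Fin d)) :
    ∃ C : ℝ, 0 ≤ C ∧ ∀ y, ‖cwd c u₀ y‖ ≤ C := by
  have hcont : Continuous (cwd c u₀) := continuous_cwd hu₀ c
  have hcs : HasCompactSupport (cwd c u₀) := hasCompactSupport_cwd hu₀c c
  obtain ⟨C, hC⟩ := hcs.exists_bound_of_continuous hcont
  exact ⟨max C 0, le_max_right _ _, fun y => (hC y).trans (le_max_left _ _)⟩

end Literature.Barriers.AtomisticToContinuum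

end
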